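import Summits.CriticalPhenomena.PercolationContinuityZ3.Theorems.SahiMasterFamilyStructDefs

/-!
# Structure theory of the zero-flag class, III: two frame failures, canonical frames, frames restrict

Unit `prim-master-conj` (crux anchor stmt-CriticalPhenomena-4575); STRUCTURE-THEORY.md §3.1–§3.4 (gen 6).  For a good chain
(`GoodChain U l`, head = last member) with frames `frameIn U l w`:
* `two_le_card_frameFail_of_mem_safe` (T'): a configuration in the safe region of the chain's family fails at least two FRAMES;
* `mem_of_frameFail_le_one` (T''): a configuration failing at most one frame lies in every member whose frame contains it; hence the
  intersection of the members is the intersection (product) of the frames (`biInter_frameIn_eq_biInter`);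
* `frameIn_eq_of_goodChain` (frame agreement): two good chains, one enumerating `W` and one enumerating `W₂ ⊆ W`, whose `l`-frames
  over `W₂` still multiply to `⋂_{W₂} U`, have the same frames on `W₂` — by the rigidity of two factorisations
  (`compl_notMem_of_two_factorisations`).  Its consequences — canonical frames and "frames restrict" — are in
  `SahiMasterFamilyStructCanonical.lean`.
Pure combinatorics; axioms standard. [this work]
-/

noncomputable section

open scoped Classical

namespace Summit.CriticalPhenomena.PercolationContinuityZ3.Theorems

open Finset Function
open Literature.Probability.LatticeModels.Kahn2022 (Affects)

variable {ι : Type*} [Fintype ι] {κ : Type*} (U : κ → Set (Set ι))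

/-! ### Suffixes of chains -/

/-- The members of a chain that come before `u` (the suffix of the list after `u`). [this work] -/
def pre : List κ → κ → List κ
  | [], _ => []
  | v :: l, u => if u = v then l else pre l u

omit [Fintype ι] in
/-- `pre` of the head. [this work] -/
@[simp] theorem pre_cons_self (v : κ) (l : List κ) : pre (v :: l) v = l := by simp [pre]

omit [Fintype ι] in
/-- `pre` of a non-head member. [this work] -/
theorem pre_cons_of_ne {u v : κ} (h : u ≠ v) (l : List κ) : pre (v :: l) u = pre l u := by simp [pre, h]

omit [Fintype ι] in
/-- A chain decomposes at any member: `l = front ++ u :: pre l u`. [this work] -/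
theorem exists_append_pre : ∀ {l : List κ} {u : κ}, u ∈ l → ∃ l₁ : List κ, l = l₁ ++ u :: pre l u
  | [], _, h => absurd h List.not_mem_nil
  | v :: l, u, h => by
    by_cases huv : u = v
    · subst huv; exact ⟨[], by simp⟩
    · obtain ⟨l₁, hl₁⟩ := exists_append_pre (List.mem_of_ne_of_mem huv h)
      exact ⟨v :: l₁, by rw [pre_cons_of_ne huv, List.cons_append, ← hl₁]⟩

omit [Fintype ι] in
/-- The members before `u` form a sub-list of the chain. [this work] -/
theorem pre_subset {l : List κ} {u : κ} (h : u ∈ l) : ∀ w ∈ pre l u, w ∈ l := by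
  obtain ⟨l₁, hl₁⟩ := exists_append_pre h
  intro w hw
  rw [hl₁]
  exact List.mem_append_right _ (List.mem_cons_of_mem _ hw)

/-- The frame of a member is its hull over the frame support of the members before it. [this work] -/
theorem frameIn_eq_hull_pre : ∀ {l : List κ} {u : κ}, u ∈ l → frameIn U l u = hull (frameSupp U (pre l u)) (U u)
  | [], _, h => absurd h List.not_mem_nil
  | v :: l, u, h => by
    by_cases huv : u = v
    · subst huv; simp [frameIn, pre]
    · rw [frameIn_cons_of_ne U huv, pre_cons_of_ne huv, frameIn_eq_hull_pre (List.mem_of_ne_of_mem huv h)]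

/-- A suffix of a good chain is good. [this work] -/
theorem GoodChain.of_append : ∀ (l₁ : List κ) {l₂ : List κ}, GoodChain U (l₁ ++ l₂) → GoodChain U l₂
  | [], _, h => h
  | _ :: l₁, _, h => GoodChain.of_append l₁ (GoodChain.tail U h)

/-- Frames of a suffix are frames of the chain (no repetitions). [this work] -/
theorem frameIn_append_of_mem : ∀ (l₁ : List κ) {l₂ : List κ} {w : κ}, (l₁ ++ l₂).Nodup → w ∈ l₂ →
    frameIn U (l₁ ++ l₂) w = frameIn U l₂ w
  | [], _, _, _, _ => rfl
  | v :: l₁, l₂, w, hn, hw => by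
    rw [List.cons_append] at hn
    have hv : v ∉ l₁ ++ l₂ := (List.nodup_cons.1 hn).1
    have hwv : w ≠ v := fun h => hv (h ▸ List.mem_append_right l₁ hw)
    rw [List.cons_append, frameIn_cons_of_ne U hwv, frameIn_append_of_mem l₁ (List.nodup_cons.1 hn).2 hw]

/-- **The annihilator of any member of a good chain is safe for the members before it.** [this work] -/
theorem annihilator_subset_safe_pre {l : List κ} (hl : GoodChain U l) {u : κ} (hu : u ∈ l) :
    frameIn U l u \ U u ⊆ Safe U (pre l u).toFinset := by
  obtain ⟨l₁, hl₁⟩ := exists_append_pre hu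
  have h2 : GoodChain U (u :: pre l u) := GoodChain.of_append U l₁ (hl₁ ▸ hl)
  rw [frameIn_eq_hull_pre U hu]
  exact ((goodChain_cons U).1 h2).2.2

/-- The members before `u`, then `u`, form a good chain; its frames are those of the whole chain. [this work] -/
theorem frameIn_pre_eq {l : List κ} (hl : GoodChain U l) {u : κ} (hu : u ∈ l) {w : κ} (hw : w ∈ pre l u) :
    frameIn U (pre l u) w = frameIn U l w := by
  obtain ⟨l₁, hl₁⟩ := exists_append_pre hu
  have hn : (l₁ ++ u :: pre l u).Nodup := hl₁ ▸ GoodChain.nodup U hl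
  have hwu : w ≠ u := by
    intro h; subst h
    have := (List.nodup_cons.1 (List.Nodup.of_append_right hn)).1
    exact this hw
  conv_rhs => rw [hl₁]
  rw [frameIn_append_of_mem U l₁ hn (List.mem_cons_of_mem u hw), frameIn_cons_of_ne U hwu]

/-! ### T′ and T″ -/

/-- The members of a chain whose FRAME fails at `φ` (`Q_φ` of STRUCTURE-THEORY, along the chain). [this work] -/
def frameFail (l : List κ) (φ : Set ι) : Finset κ := l.toFinset.filter fun w => φ ∉ frameIn U l w

/-- Membership in the frame-fail set. [this work] -/
@[simp] theorem mem_frameFail {l : List κ} {φ : Set ι} {w : κ} : w ∈ frameFail U l φ ↔ w ∈ l ∧ φ ∉ frameIn U l w := by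
  simp [frameFail]

/-- Frame failures are member failures. [this work] -/
theorem frameFail_subset_failSet (hU : ∀ k, IsUpperSet (U k)) (l : List κ) (φ : Set ι) :
    frameFail U l φ ⊆ failSet U l.toFinset φ := by
  intro w hw
  rw [mem_frameFail] at hw
  exact (mem_failSet U).2 ⟨List.mem_toFinset.2 hw.1, fun h => hw.2 (subset_frameIn U hU l w h)⟩

/-- **T′: a safe configuration fails at least two frames** (STRUCTURE-THEORY 3.1).  More precisely, for a good chain `l` and a
configuration `φ` that is either in the safe region of `l` or in the annihilator of a member of `l`, at least two frames of `l` fail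
at `φ`. [this work] -/
theorem two_le_card_frameFail : ∀ (n : ℕ) {l : List κ}, l.length ≤ n → GoodChain U l → (∀ k, IsUpperSet (U k)) → ∀ φ : Set ι,
    (φ ∈ Safe U l.toFinset ∨ ∃ u ∈ l, φ ∈ frameIn U l u ∧ φ ∉ U u) → 2 ≤ (frameFail U l φ).card
  | 0, l, hn, _, _, φ, h => by
    have : l = [] := List.eq_nil_of_length_eq_zero (Nat.le_zero.1 hn)
    subst this
    rcases h with h | ⟨u, hu, -⟩
    · rw [List.toFinset_nil, safe_eq_empty_of_card_le_one U (by simp)] at h; exact absurd h (Set.notMem_empty φ)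
    · exact absurd hu List.not_mem_nil
  | n + 1, l, hn, hl, hU, φ, h => by
    -- annihilated by some `u`: safe for the members before `u`, a shorter good chain
    have hann : ∀ u ∈ l, φ ∈ frameIn U l u → φ ∉ U u → 2 ≤ (frameFail U l φ).card := by
      intro u hu hφA hφU
      have hsafe : φ ∈ Safe U (pre l u).toFinset := annihilator_subset_safe_pre U hl hu ⟨hφA, hφU⟩
      obtain ⟨l₁, hl₁⟩ := exists_append_pre hu
      have hpre : GoodChain U (pre l u) := GoodChain.tail U (GoodChain.of_append U l₁ (hl₁ ▸ hl))
      have hlen : (pre l u).length ≤ n := by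
        have e : l.length = (l₁ ++ u :: pre l u).length := congrArg List.length hl₁
        simp only [List.length_append, List.length_cons] at e
        omega
      have ih := two_le_card_frameFail n hlen hpre hU φ (Or.inl hsafe)
      refine ih.trans (card_le_card fun w hw => ?_)
      rw [mem_frameFail] at hw ⊢
      exact ⟨pre_subset hu w hw.1, by rw [← frameIn_pre_eq U hl hu hw.1]; exact hw.2⟩
    rcases h with h | ⟨u, hu, hφA, hφU⟩
    · -- safe: either some annihilator contains `φ`, or the member failures are frame failures
      by_cases hex : ∃ u ∈ l, φ ∈ frameIn U l u ∧ φ ∉ U u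
      · obtain ⟨u, hu, h1, h2⟩ := hex
        exact hann u hu h1 h2
      · push Not at hex
        have hsub : failSet U l.toFinset φ ⊆ frameFail U l φ := by
          intro w hw
          rw [mem_failSet] at hw
          rw [mem_frameFail]
          have hwl : w ∈ l := List.mem_toFinset.1 hw.1
          exact ⟨hwl, fun hA => hw.2 (hex w hwl hA)⟩
        exact ((mem_safe U).1 h).1.trans (card_le_card hsub)
    · exact hann u hu hφA hφU

/-- **T″: one frame failure costs nothing** (STRUCTURE-THEORY 3.2): in a good chain, a configuration failing at most one frame lies in
every member whose frame contains it. [this work] -/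
theorem mem_of_frameFail_card_le_one {l : List κ} (hl : GoodChain U l) (hU : ∀ k, IsUpperSet (U k)) {φ : Set ι}
    (h1 : (frameFail U l φ).card ≤ 1) {w : κ} (hw : w ∈ l) (hφ : φ ∈ frameIn U l w) : φ ∈ U w := by
  by_contra hφU
  have := two_le_card_frameFail U l.length le_rfl hl hU φ (Or.inr ⟨w, hw, hφ, hφU⟩)
  omega

/-- A configuration in all frames but possibly one fails at most one frame (bookkeeping). [this work] -/
theorem frameFail_card_le_one_of_forall {l : List κ} {φ : Set ι} (w : κ) (h : ∀ u ∈ l, u ≠ w → φ ∈ frameIn U l u) :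
    (frameFail U l φ).card ≤ 1 := by
  refine card_le_one.2 fun a ha b hb => ?_
  rw [mem_frameFail] at ha hb
  have ha' : a = w := by by_contra hne; exact ha.2 (h a ha.1 hne)
  have hb' : b = w := by by_contra hne; exact hb.2 (h b hb.1 hne)
  rw [ha', hb']

/-- **The members of a good chain multiply to the product of their frames**: `⋂_{w ∈ l} U w = ⋂_{w ∈ l} frameIn U l w`, and the same
over any sub-family missing at most... (here: the whole family and the family minus one member). [this work] -/
theorem biInter_frameIn_subset_biInter {l : List κ} (hl : GoodChain U l) (hU : ∀ k, IsUpperSet (U k)) (W₂ : Finset κ)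
    (hW₂ : W₂ ⊆ l.toFinset) (hco : (l.toFinset \ W₂).card ≤ 1) :
    (⋂ w ∈ W₂, frameIn U l w) ⊆ ⋂ w ∈ W₂, U w := by
  intro φ hφ
  rw [Set.mem_iInter₂] at hφ ⊢
  intro w hw
  refine mem_of_frameFail_card_le_one U hl hU ?_ (List.mem_toFinset.1 (hW₂ hw)) (hφ w hw)
  refine (card_le_card ?_).trans hco
  intro u hu
  rw [mem_frameFail] at hu
  rw [mem_sdiff]
  exact ⟨List.mem_toFinset.2 hu.1, fun huW => hu.2 (hφ u huW)⟩

/-- `⋂_{w ∈ W₂} U w = ⋂_{w ∈ W₂} frameIn U l w` for `W₂` the chain's family minus at most one member. [this work] -/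
theorem biInter_eq_biInter_frameIn {l : List κ} (hl : GoodChain U l) (hU : ∀ k, IsUpperSet (U k)) (W₂ : Finset κ)
    (hW₂ : W₂ ⊆ l.toFinset) (hco : (l.toFinset \ W₂).card ≤ 1) :
    (⋂ w ∈ W₂, U w) = ⋂ w ∈ W₂, frameIn U l w :=
  Set.Subset.antisymm (Set.iInter₂_mono fun w _ => subset_frameIn U hU l w) (biInter_frameIn_subset_biInter U hl hU W₂ hW₂ hco)

/-! ### Frame agreement -/

/-- **Frame agreement.**  Let `l` be a good chain enumerating `W` and `l₂` a good chain enumerating `W₂ ⊆ W`, and suppose the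
`l`-frames over `W₂` still multiply to `⋂_{W₂} U` (true for `W₂ = W` and for `W₂ = W ∖ v`).  Then the two chains give every member of
`W₂` the same frame.  [Rigidity of the two factorisations of `⋂_{W₂} U`, T″ for both chains, and the hull formula for a factor.]
[this work] -/
theorem frameIn_eq_of_goodChain (hU : ∀ k, IsUpperSet (U k)) (hne : ∀ k, (U k).Nonempty) {l l₂ : List κ} (hl : GoodChain U l)
    (hl₂ : GoodChain U l₂) (hsub : l₂.toFinset ⊆ l.toFinset)
    (hprod : (⋂ w ∈ l₂.toFinset, frameIn U l w) ⊆ ⋂ w ∈ l₂.toFinset, U w) {w : κ} (hw : w ∈ l₂) :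
    frameIn U l₂ w = frameIn U l w := by
  set W₂ := l₂.toFinset with hW₂
  have hn := GoodChain.nodup U hl
  have hn₂ := GoodChain.nodup U hl₂
  -- the two factorisations of `⋂_{W₂} U`
  have hA : ∀ j ∈ W₂, IsUpperSet (frameIn U l j) := fun j _ => isUpperSet_frameIn U hU l j
  have hAne : ∀ j ∈ W₂, (frameIn U l j).Nonempty := fun j _ => frameIn_nonempty U hU hne l j
  have hAd : ∀ j ∈ W₂, ∀ j' ∈ W₂, j ≠ j' → Disjoint (esupp (frameIn U l j)) (esupp (frameIn U l j')) :=
    fun j hj j' hj' hne' => disjoint_esupp_frameIn U hn (List.mem_toFinset.1 (hsub hj)) (List.mem_toFinset.1 (hsub hj')) hne'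
  have hB : ∀ j ∈ W₂, IsUpperSet (frameIn U l₂ j) := fun j _ => isUpperSet_frameIn U hU l₂ j
  have hBne : ∀ j ∈ W₂, (frameIn U l₂ j).Nonempty := fun j _ => frameIn_nonempty U hU hne l₂ j
  have hBd : ∀ j ∈ W₂, ∀ j' ∈ W₂, j ≠ j' → Disjoint (esupp (frameIn U l₂ j)) (esupp (frameIn U l₂ j')) :=
    fun j hj j' hj' hne' => disjoint_esupp_frameIn U hn₂ (List.mem_toFinset.1 hj) (List.mem_toFinset.1 hj') hne'
  have eqA : (⋂ j ∈ W₂, frameIn U l j) = ⋂ j ∈ W₂, U j :=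
    Set.Subset.antisymm hprod (Set.iInter₂_mono fun j _ => subset_frameIn U hU l j)
  have eqB : (⋂ j ∈ W₂, U j) = ⋂ j ∈ W₂, frameIn U l₂ j :=
    biInter_eq_biInter_frameIn U hl₂ hU W₂ subset_rfl (by simp [hW₂])
  have hAB : (⋂ j ∈ W₂, frameIn U l j) = ⋂ j ∈ W₂, frameIn U l₂ j := eqA.trans eqB
  -- across the two factorisations, blocks of different members do not meet
  have cross : ∀ a ∈ W₂, ∀ b ∈ W₂, a ≠ b → Disjoint (esupp (frameIn U l a)) (esupp (frameIn U l₂ b)) := by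
    intro a ha b hb hab
    rw [Finset.disjoint_iff_inter_eq_empty]
    by_contra hP
    have hPne : (esupp (frameIn U l a) ∩ esupp (frameIn U l₂ b)).Nonempty := nonempty_iff_ne_empty.2 hP
    have rig := compl_notMem_of_two_factorisations (fun j => frameIn U l j) W₂ (fun j => frameIn U l₂ j) W₂ hA hAne hAd hB hBd
      hAB ha hb hPne
    apply rig
    -- `Pᶜ` lies in every member of `W₂`
    set P : Finset ι := esupp (frameIn U l a) ∩ esupp (frameIn U l₂ b) with hPdef
    -- via `l`: `Pᶜ` is in every `l`-frame other than that of `a`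
    have inA : ∀ u ∈ l, u ≠ a → ((↑P)ᶜ : Set ι) ∈ frameIn U l u := by
      intro u hu hua
      refine mem_of_esupp_subset (isUpperSet_frameIn U hU l u) (frameIn_nonempty U hU hne l u) fun i hi => ?_
      rw [Set.mem_compl_iff, mem_coe, hPdef, mem_inter, not_and_or]
      left
      exact fun hia => Finset.disjoint_left.1 (disjoint_esupp_frameIn U hn hu (List.mem_toFinset.1 (hsub ha)) hua) hi hia
    have inB : ∀ u ∈ l₂, u ≠ b → ((↑P)ᶜ : Set ι) ∈ frameIn U l₂ u := by
      intro u hu hub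
      refine mem_of_esupp_subset (isUpperSet_frameIn U hU l₂ u) (frameIn_nonempty U hU hne l₂ u) fun i hi => ?_
      rw [Set.mem_compl_iff, mem_coe, hPdef, mem_inter, not_and_or]
      right
      exact fun hib => Finset.disjoint_left.1 (disjoint_esupp_frameIn U hn₂ hu (List.mem_toFinset.1 hb) hub) hi hib
    have memU : ∀ u ∈ W₂, ((↑P)ᶜ : Set ι) ∈ U u := by
      intro u hu
      by_cases hua : u = a
      · -- use the chain `l₂`: `Pᶜ` fails at most the `l₂`-frame of `b`, and `a ≠ b`
        subst hua
        exact mem_of_frameFail_card_le_one U hl₂ hU (frameFail_card_le_one_of_forall U b inB) (List.mem_toFinset.1 hu)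
          (inB u (List.mem_toFinset.1 hu) hab)
      · exact mem_of_frameFail_card_le_one U hl hU (frameFail_card_le_one_of_forall U a inA)
          (List.mem_toFinset.1 (hsub hu)) (inA u (List.mem_toFinset.1 (hsub hu)) hua)
    rw [eqA]
    exact Set.mem_iInter₂.2 memU
  -- hence the blocks agree
  have suppA : (↑(esupp (frameIn U l w)) : Set ι) ⊆ ↑(esupp (frameIn U l₂ w)) := by
    intro i hi
    have hi' : i ∈ esupp (⋂ j ∈ W₂, frameIn U l j) :=
      subset_esupp_biInter_of_frame _ W₂ hA hAne hAd (List.mem_toFinset.2 hw) (mem_coe.1 hi)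
    rw [hAB] at hi'
    have := esupp_biInter_subset (fun j => frameIn U l₂ j) W₂ hi'
    rw [mem_biUnion] at this
    obtain ⟨u, hu, hiu⟩ := this
    by_cases huw : u = w
    · subst huw; exact mem_coe.2 hiu
    · exact absurd hiu (Finset.disjoint_left.1 (cross w (List.mem_toFinset.2 hw) u hu (Ne.symm huw)) (mem_coe.1 hi))
  have suppB : (↑(esupp (frameIn U l₂ w)) : Set ι) ⊆ ↑(esupp (frameIn U l w)) := by
    intro i hi
    have hi' : i ∈ esupp (⋂ j ∈ W₂, frameIn U l₂ j) :=
      subset_esupp_biInter_of_frame _ W₂ hB hBne hBd (List.mem_toFinset.2 hw) (mem_coe.1 hi)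
    rw [← hAB] at hi'
    have := esupp_biInter_subset (fun j => frameIn U l j) W₂ hi'
    rw [mem_biUnion] at this
    obtain ⟨u, hu, hiu⟩ := this
    by_cases huw : u = w
    · subst huw; exact mem_coe.2 hiu
    · exact absurd (mem_coe.1 hi) (Finset.disjoint_left.1 (cross u hu w (List.mem_toFinset.2 hw) huw) hiu)
  -- and the frames are the hulls of the common product over the other blocks
  have others : ((W₂.erase w).biUnion fun j => esupp (frameIn U l j)) = (W₂.erase w).biUnion fun j => esupp (frameIn U l₂ j) := by
    -- both equal `esupp (product) \ (block of w)`; use the two support inclusions member by member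
    have key : ∀ u ∈ W₂, esupp (frameIn U l u) = esupp (frameIn U l₂ u) := by
      intro u hu
      -- rerun the block comparison for `u` (symmetric roles); we only need it via the set inclusions proved for general members
      apply Finset.Subset.antisymm
      · intro i hi
        have hi' : i ∈ esupp (⋂ j ∈ W₂, frameIn U l j) := subset_esupp_biInter_of_frame _ W₂ hA hAne hAd hu hi
        rw [hAB] at hi'
        have := esupp_biInter_subset (fun j => frameIn U l₂ j) W₂ hi'
        rw [mem_biUnion] at this
        obtain ⟨u', hu', hiu'⟩ := this
        by_cases h' : u' = u
        · subst h'; exact hiu'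
        · exact absurd hiu' (Finset.disjoint_left.1 (cross u hu u' hu' (Ne.symm h')) hi)
      · intro i hi
        have hi' : i ∈ esupp (⋂ j ∈ W₂, frameIn U l₂ j) := subset_esupp_biInter_of_frame _ W₂ hB hBne hBd hu hi
        rw [← hAB] at hi'
        have := esupp_biInter_subset (fun j => frameIn U l j) W₂ hi'
        rw [mem_biUnion] at this
        obtain ⟨u', hu', hiu'⟩ := this
        by_cases h' : u' = u
        · subst h'; exact hiu'
        · exact absurd hi (Finset.disjoint_left.1 (cross u' hu' u hu h') hiu')
    exact biUnion_congr rfl fun u hu => key u (mem_of_mem_erase hu)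
  have fA := hull_biInter_of_frame (fun j => frameIn U l j) W₂ hA hAne hAd (List.mem_toFinset.2 hw)
  have fB := hull_biInter_of_frame (fun j => frameIn U l₂ j) W₂ hB hBne hBd (List.mem_toFinset.2 hw)
  rw [← fA, ← fB, hAB, others]

end Summit.CriticalPhenomena.PercolationContinuityZ3.Theorems
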